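import Literature.RepresentationTheory.HeisenbergGroup.ImplementerCocycleClass
import HarnessLib

/-!
# Transport of implementers, sections and their cocycles: twisting by a `1`-cochain, and isomorphic Heisenberg data

Topic `RepresentationTheory/HeisenbergGroup`; namespace `Literature.RepresentationTheory.HeisenbergGroup`. KERNEL
mathematics only (definitions with bodies + theorems; no named fact, no `axiom`, no `sorry`). Sequel of
`ImplementerCocycle.lean` / `ImplementerCocycleClass.lean` (sections of implementers `r : Sp(V,B) → GL(S)` of a model
`ρ` of `Heisenberg B`, their cocycles `c_r`, `c_{r'} = c_r · ∂ν`).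

* §1 **twisting a section by a normalised `1`-cochain** `ν : Sp(V,B) → kˣ`, `ν(1) = 1`: `(ν • r)(g) = ν(g) r(g)` is
  again a normalised section of implementers (`ImplementerSection.twist`) and **its cocycle is
  `c_{ν•r}(g,g') = c_r(g,g') ν(g) ν(g') ν(gg')⁻¹`**, i.e. `c_{ν • r} = c_r.twist ν⁻¹` in the tree's `CentralCocycle.twist`
  (`ImplementerSection.cocycle_twist`) — so EVERY cocycle cohomologous to `c_r` by an explicit coboundary is the
  cocycle of an explicit section ([MoeglinVignerasWaldspurger1987] Chap. 2 II.1: "`M` est unique à un scalaire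
  près"; [Rangarao1993] §3.2–3.5: normalising the section changes the cocycle by a coboundary).
* §2 **transport along an isomorphism of Heisenberg data**: a linear equivalence `e : V ≃ V'` with
  `B'(e v, e w) = B(v, w)` induces `Heisenberg B ≃* Heisenberg B'` (`Heisenberg.mapEquiv`, `(v, t) ↦ (e v, t)`),
  `Sp(V,B) ≃* Sp(V',B')` (`symplecticConj`, `g ↦ e g e⁻¹`) compatibly with Weil's sections `ofSymplectic`
  (`ofSymplectic_symplecticConj_act`); for models `ρ` of `Heisenberg B` and `ρ'` of `Heisenberg B'` on the SAME space
  `S` with `ρ = ρ' ∘ mapEquiv`: `M` implements `g` for `ρ` iff it implements `e g e⁻¹` for `ρ'`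
  (`implements_iff_implements_symplecticConj`), hence uniqueness up to scalars and existence of implementers
  transfer (`ImplementerUniqueUpToScalar.of_transport`, `ExistsImplementer.of_transport`), a section `r'` of `ρ'`
  pulls back to the section `g ↦ r'(e g e⁻¹)` of `ρ` (`ImplementerSection.transport`) and
  **`c_{transport r'}(g, g') = c_{r'}(e g e⁻¹, e g' e⁻¹)`** (`ImplementerSection.cocycle_transport`).
  This is the (trivial) functoriality used to move the Schrödinger model of `𝒮(F^ι)` between the standard
  duality `⟨x, y⟩` and a Gram duality `⟨x, T y⟩` ([MoeglinVignerasWaldspurger1987] Chap. 2 I.4, II.1; [Weil1964] n° 5,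
  n° 34 "changement de base").

## References

* [MoeglinVignerasWaldspurger1987] C. Mœglin, M.-F. Vignéras, J.-L. Waldspurger, *Correspondances de Howe sur un
  corps p-adique*, LNM 1291 (1987), Chap. 2 I.4, II.1 (A)–(B).
* [Rangarao1993] R. Ranga Rao, *On some explicit formulas in the theory of Weil representation*, Pacific J. Math.
  157 (1993) 335–371, §3.2–3.5.
* [Weil1964] A. Weil, *Sur certains groupes d'opérateurs unitaires*, Acta Math. 111 (1964), n° 5, n° 34.
-/

set_option autoImplicit false

noncomputable section

namespace Literature.RepresentationTheory.HeisenbergGroup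

open Literature.GroupTheory

universe u v w u' v'

/-! ## §1 Twisting a section of implementers by a normalised `1`-cochain -/

section Twist

variable {R : Type u} [CommRing R] [Invertible (2 : R)] {V : Type v} [AddCommGroup V] [Module R V]
  {B : V →ₗ[R] V →ₗ[R] R}
variable {k : Type u'} [Field k] {S : Type v'} [AddCommGroup S] [Module k S]
variable {ρ : Representation k (Heisenberg B) S}

omit [Invertible (2 : R)] in
/-- (A) is stable under scalars: if `M` implements `s` then so does `c · M`.
[cite: MoeglinVignerasWaldspurger1987, Chap. 2 II.1 (A)] -/
theorem Implements.scalarOp_mul {s : Heisenberg.PseudoSymplectic B} {M : S ≃ₗ[k] S} (hM : Implements ρ s M)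
    (c : kˣ) : Implements ρ s (scalarOp c * M) := by
  intro h f
  rw [LinearEquiv.mul_apply, LinearEquiv.mul_apply, scalarOp_apply, scalarOp_apply, hM, map_smul]

namespace ImplementerSection

variable (r : ImplementerSection ρ) (ν : symplecticGroup B → kˣ) (hν : ν 1 = 1)

/-- **the twisted section `(ν • r)(g) = ν(g) · r(g)`** of a section of implementers by a normalised `1`-cochain
`ν : Sp(V,B) → kˣ` (`ν(1) = 1`) — again a normalised section of implementers.
[cite: MoeglinVignerasWaldspurger1987, Chap. 2 II.1 (A); Rangarao1993, §3.5] -/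
def twist : ImplementerSection ρ where
  toFun g := scalarOp (ν g) * r g
  implements' g := (r.implements g).scalarOp_mul (ν g)
  map_one' := by
    rw [hν, r.map_one]
    refine LinearEquiv.ext fun f => ?_
    rw [LinearEquiv.mul_apply, scalarOp_apply, Units.val_one, one_smul]

/-- `(ν • r)(g) f = ν(g) • r(g) f`. [cite: MoeglinVignerasWaldspurger1987, Chap. 2 II.1 (A)] -/
@[simp] theorem twist_apply (g : symplecticGroup B) (f : S) : r.twist ν hν g f = (ν g : k) • r g f := rfl

variable (hU : ImplementerUniqueUpToScalar ρ) [Nontrivial S]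

/-- the ratio `r / (ν • r)` is `ν⁻¹`. [cite: MoeglinVignerasWaldspurger1987, Chap. 2 II.1 (A)] -/
theorem sectionRatio_twist (g : symplecticGroup B) : sectionRatio r (r.twist ν hν) hU g = (ν g)⁻¹ :=
  (sectionRatio_unique r (r.twist ν hν) hU fun f => by
    rw [twist_apply, smul_smul, Units.val_inv_eq_inv_val, inv_mul_cancel₀ (ν g).ne_zero, one_smul]).symm

/-- **the cocycle of the twisted section**: `c_{ν•r} = c_r.twist ν⁻¹`, i.e.
`c_{ν•r}(g, g') = c_r(g, g') ν(gg')⁻¹ ν(g) ν(g')`. [cite: MoeglinVignerasWaldspurger1987, Chap. 2 II.1 (A)–(B); Rangarao1993, §3.5] -/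
theorem cocycle_twist :
    (r.twist ν hν).cocycle hU = (r.cocycle hU).twist (fun g => (ν g)⁻¹) (by rw [hν, inv_one]) := by
  rw [cocycle_eq_twist r (r.twist ν hν) hU]
  refine CentralCocycle.ext fun g g' => ?_
  simp only [CentralCocycle.twist_apply, sectionRatio_twist]

/-- pointwise: `c_{ν•r}(g, g') = c_r(g, g') · ν(g) ν(g') ν(gg')⁻¹`.
[cite: MoeglinVignerasWaldspurger1987, Chap. 2 II.1 (A)–(B)] -/
theorem cocycle_twist_apply (g g' : symplecticGroup B) :
    (r.twist ν hν).cocycle hU g g' = r.cocycle hU g g' * ν g * ν g' * (ν (g * g'))⁻¹ := by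
  rw [cocycle_twist, CentralCocycle.twist_apply, inv_inv, inv_inv]
  simp only [mul_comm, mul_left_comm]

/-- **realising a cohomologous cocycle**: if `c' = c_r.twist λ` for a normalised `1`-cochain `λ`, then `c'` IS the
cocycle of the section `λ⁻¹ • r`. [cite: MoeglinVignerasWaldspurger1987, Chap. 2 II.1 (A)–(B); Rangarao1993, §3.5] -/
theorem cocycle_twist_inv (lam : symplecticGroup B → kˣ) (hlam : lam 1 = 1) :
    (r.twist (fun g => (lam g)⁻¹) (by rw [hlam, inv_one])).cocycle hU = (r.cocycle hU).twist lam hlam := by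
  rw [cocycle_twist]
  refine CentralCocycle.ext fun g g' => ?_
  simp only [CentralCocycle.twist_apply, inv_inv]

end ImplementerSection

end Twist

/-! ## §2 Transport along an isomorphism of Heisenberg data -/

section Transport

variable {R : Type u} [CommRing R] {V : Type v} [AddCommGroup V] [Module R V]
  {V' : Type w} [AddCommGroup V'] [Module R V']
  {B : V →ₗ[R] V →ₗ[R] R} {B' : V' →ₗ[R] V' →ₗ[R] R}
  (e : V ≃ₗ[R] V') (hB : ∀ v w : V, B' (e v) (e w) = B v w)

include hB in
/-- the hypothesis read backwards: `B(e⁻¹ v', e⁻¹ w') = B'(v', w')`. [cite: Weil1964, n° 5, p. 150] -/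
theorem form_symm_symm (v' w' : V') : B (e.symm v') (e.symm w') = B' v' w' := by
  rw [← hB, LinearEquiv.apply_symm_apply, LinearEquiv.apply_symm_apply]

/-- **`(v, t) ↦ (e v, t)` is an isomorphism `Heisenberg B ≃* Heisenberg B'`** when `B' ∘ (e × e) = B`
(Weil's "changement de base" of the data `(G, B)`). [cite: Weil1964, n° 5, p. 150; MoeglinVignerasWaldspurger1987, Chap. 2 I.1] -/
def Heisenberg.mapEquiv : Heisenberg B ≃* Heisenberg B' where
  toFun a := ⟨e a.v, a.t⟩
  invFun a' := ⟨e.symm a'.v, a'.t⟩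
  left_inv a := by
    apply Heisenberg.ext
    · exact e.symm_apply_apply a.v
    · rfl
  right_inv a' := by
    apply Heisenberg.ext
    · exact e.apply_symm_apply a'.v
    · rfl
  map_mul' a b := by
    apply Heisenberg.ext
    · exact map_add e a.v b.v
    · show a.t + b.t + B a.v b.v = a.t + b.t + B' (e a.v) (e b.v)
      rw [hB]

/-- components: `(mapEquiv a).v = e a.v`. [cite: Weil1964, n° 5, p. 150] -/
@[simp] theorem Heisenberg.mapEquiv_v (a : Heisenberg B) : (Heisenberg.mapEquiv e hB a).v = e a.v := rfl

/-- components: `(mapEquiv a).t = a.t`. [cite: Weil1964, n° 5, p. 150] -/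
@[simp] theorem Heisenberg.mapEquiv_t (a : Heisenberg B) : (Heisenberg.mapEquiv e hB a).t = a.t := rfl

/-- the inverse: `(mapEquiv⁻¹ a').v = e⁻¹ a'.v`. [cite: Weil1964, n° 5, p. 150] -/
@[simp] theorem Heisenberg.mapEquiv_symm_v (a' : Heisenberg B') :
    ((Heisenberg.mapEquiv e hB).symm a').v = e.symm a'.v := rfl

/-- the inverse: `(mapEquiv⁻¹ a').t = a'.t`. [cite: Weil1964, n° 5, p. 150] -/
@[simp] theorem Heisenberg.mapEquiv_symm_t (a' : Heisenberg B') :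
    ((Heisenberg.mapEquiv e hB).symm a').t = a'.t := rfl

include hB in
/-- `e g e⁻¹` preserves the commutator form of `B'` when `g` preserves that of `B`. [cite: Weil1964, n° 5, p. 150] -/
theorem conj_mem_symplecticGroup (g : symplecticGroup B) :
    (e.symm ≪≫ₗ (g : V ≃ₗ[R] V) ≪≫ₗ e) ∈ symplecticGroup B' := by
  rw [mem_symplecticGroup]
  intro v' w'
  simp only [LinearEquiv.trans_apply, hB]
  rw [(mem_symplecticGroup B _).1 g.2, form_symm_symm e hB, form_symm_symm e hB]

/-- **conjugation `g ↦ e g e⁻¹ : Sp(V,B) ≃* Sp(V',B')`** along the isomorphism of Heisenberg data.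
[cite: Weil1964, n° 5, p. 150; n° 34, p. 182] -/
def symplecticConj : symplecticGroup B ≃* symplecticGroup B' where
  toFun g := ⟨e.symm ≪≫ₗ (g : V ≃ₗ[R] V) ≪≫ₗ e, conj_mem_symplecticGroup e hB g⟩
  invFun g' := ⟨e ≪≫ₗ (g' : V' ≃ₗ[R] V') ≪≫ₗ e.symm,
    conj_mem_symplecticGroup (B := B') (B' := B) e.symm (form_symm_symm e hB) g'⟩
  left_inv g := by
    apply Subtype.ext
    refine LinearEquiv.ext fun v => ?_
    simp only [LinearEquiv.trans_apply, LinearEquiv.symm_apply_apply]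
  right_inv g' := by
    apply Subtype.ext
    refine LinearEquiv.ext fun v' => ?_
    simp only [LinearEquiv.trans_apply, LinearEquiv.apply_symm_apply]
  map_mul' g g' := by
    apply Subtype.ext
    refine LinearEquiv.ext fun v' => ?_
    simp only [Subgroup.coe_mul, LinearEquiv.trans_apply, LinearEquiv.mul_apply, LinearEquiv.symm_apply_apply]

/-- formula: `(e g e⁻¹) v' = e (g (e⁻¹ v'))`. [cite: Weil1964, n° 5, p. 150] -/
@[simp] theorem symplecticConj_apply (g : symplecticGroup B) (v' : V') :
    ((symplecticConj e hB g : symplecticGroup B') : V' ≃ₗ[R] V') v' = e ((g : V ≃ₗ[R] V) (e.symm v')) := rfl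

/-- the underlying linear equivalence of `e g e⁻¹`. [cite: Weil1964, n° 5, p. 150] -/
theorem coe_symplecticConj (g : symplecticGroup B) :
    ((symplecticConj e hB g : symplecticGroup B') : V' ≃ₗ[R] V') = e.symm ≪≫ₗ (g : V ≃ₗ[R] V) ≪≫ₗ e := rfl

/-- formula for the inverse: `(e⁻¹ g' e) v = e⁻¹ (g' (e v))`. [cite: Weil1964, n° 5, p. 150] -/
@[simp] theorem symplecticConj_symm_apply (g' : symplecticGroup B') (v : V) :
    (((symplecticConj e hB).symm g' : symplecticGroup B) : V ≃ₗ[R] V) v = e.symm ((g' : V' ≃ₗ[R] V') (e v)) := rfl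

variable [Invertible (2 : R)]

/-- **Weil's sections are compatible with the transport**: `s'(e g e⁻¹) · φ(a) = φ(s(g) · a)` for
`φ = mapEquiv`, `s = ofSymplectic` (the `f`-components agree since `B'(e·, e·) = B`).
[cite: Weil1964, n° 5, pp. 150–151] -/
theorem ofSymplectic_symplecticConj_act (g : symplecticGroup B) (a : Heisenberg B) :
    (ofSymplectic B' (symplecticConj e hB g)).act (Heisenberg.mapEquiv e hB a) =
      Heisenberg.mapEquiv e hB ((ofSymplectic B g).act a) := by
  apply Heisenberg.ext
  · simp only [Heisenberg.PseudoSymplectic.act_v, ofSymplectic_σ, Heisenberg.mapEquiv_v, symplecticConj_apply,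
      LinearEquiv.symm_apply_apply]
  · simp only [Heisenberg.PseudoSymplectic.act_t, ofSymplectic_f, Heisenberg.mapEquiv_t, Heisenberg.mapEquiv_v,
      symplecticConj_apply, LinearEquiv.symm_apply_apply, hB]

variable {k : Type u'} [Field k] {S : Type v'} [AddCommGroup S] [Module k S]
  {ρ : Representation k (Heisenberg B) S} {ρ' : Representation k (Heisenberg B') S}
  (hρ : ∀ a : Heisenberg B, ρ a = ρ' (Heisenberg.mapEquiv e hB a))

omit [Invertible (2 : R)] in
include hρ in
/-- `ρ` read through `ρ'`: `ρ(φ⁻¹ a') = ρ'(a')`. [cite: MoeglinVignerasWaldspurger1987, Chap. 2 I.4] -/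
theorem rep_mapEquiv_symm (a' : Heisenberg B') : ρ ((Heisenberg.mapEquiv e hB).symm a') = ρ' a' := by
  rw [hρ, MulEquiv.apply_symm_apply]

include hρ in
/-- **`M` implements `g` for `ρ = ρ' ∘ φ` iff `M` implements `e g e⁻¹` for `ρ'`**.
[cite: MoeglinVignerasWaldspurger1987, Chap. 2 II.1 (A)] -/
theorem implements_iff_implements_symplecticConj (g : symplecticGroup B) (M : S ≃ₗ[k] S) :
    Implements ρ (ofSymplectic B g) M ↔ Implements ρ' (ofSymplectic B' (symplecticConj e hB g)) M := by
  constructor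
  · intro hM a' f
    have h := hM ((Heisenberg.mapEquiv e hB).symm a') f
    rw [rep_mapEquiv_symm e hB hρ, hρ, ← ofSymplectic_symplecticConj_act, MulEquiv.apply_symm_apply] at h
    exact h
  · intro hM a f
    have h := hM (Heisenberg.mapEquiv e hB a) f
    rw [ofSymplectic_symplecticConj_act, ← hρ, ← hρ] at h
    exact h

include hρ in
/-- **uniqueness of implementers up to scalars transfers** from `ρ'` to `ρ = ρ' ∘ φ`.
[cite: MoeglinVignerasWaldspurger1987, Chap. 2 II.1 (A)] -/
theorem ImplementerUniqueUpToScalar.of_transport (hU' : ImplementerUniqueUpToScalar ρ') :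
    ImplementerUniqueUpToScalar ρ := fun g M M' hM hM' =>
  hU' (symplecticConj e hB g) M M' ((implements_iff_implements_symplecticConj e hB hρ g M).1 hM)
    ((implements_iff_implements_symplecticConj e hB hρ g M').1 hM')

include hρ in
/-- **existence of implementers transfers** from `ρ'` to `ρ = ρ' ∘ φ`.
[cite: MoeglinVignerasWaldspurger1987, Chap. 2 II.1 (A)] -/
theorem ExistsImplementer.of_transport (hE' : ExistsImplementer ρ') : ExistsImplementer ρ := fun g => by
  obtain ⟨M, hM⟩ := hE' (symplecticConj e hB g)
  exact ⟨M, (implements_iff_implements_symplecticConj e hB hρ g M).2 hM⟩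

namespace ImplementerSection

/-- **pull-back of a section of implementers**: `(transport r')(g) = r'(e g e⁻¹)`.
[cite: MoeglinVignerasWaldspurger1987, Chap. 2 II.1 (A)] -/
def transport (r' : ImplementerSection ρ') : ImplementerSection ρ where
  toFun g := r' (symplecticConj e hB g)
  implements' g := (implements_iff_implements_symplecticConj e hB hρ g _).2 (r'.implements _)
  map_one' := by rw [_root_.map_one]; exact r'.map_one

/-- formula. [cite: MoeglinVignerasWaldspurger1987, Chap. 2 II.1 (A)] -/
@[simp] theorem transport_apply (r' : ImplementerSection ρ') (g : symplecticGroup B) :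
    transport e hB hρ r' g = r' (symplecticConj e hB g) := rfl

variable [Nontrivial S]

/-- **the cocycle of the pulled-back section is the pulled-back cocycle**:
`c_{transport r'}(g, g') = c_{r'}(e g e⁻¹, e g' e⁻¹)`. [cite: MoeglinVignerasWaldspurger1987, Chap. 2 II.1 (A)–(B)] -/
theorem cocycle_transport (r' : ImplementerSection ρ') (hU : ImplementerUniqueUpToScalar ρ)
    (hU' : ImplementerUniqueUpToScalar ρ') (g g' : symplecticGroup B) :
    (transport e hB hρ r').cocycle hU g g' = r'.cocycle hU' (symplecticConj e hB g) (symplecticConj e hB g') := by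
  rw [cocycle_apply, cocycle_apply]
  refine ((transport e hB hρ r').cocycleFun_unique hU fun f => ?_).symm
  rw [transport_apply, transport_apply, transport_apply, map_mul]
  exact r'.mul_apply hU' _ _ f

/-- the same, as an identity of functions of two variables. [cite: MoeglinVignerasWaldspurger1987, Chap. 2 II.1 (A)–(B)] -/
theorem cocycle_transport_eq (r' : ImplementerSection ρ') (hU : ImplementerUniqueUpToScalar ρ)
    (hU' : ImplementerUniqueUpToScalar ρ') :
    ⇑((transport e hB hρ r').cocycle hU) = fun g g' => r'.cocycle hU' (symplecticConj e hB g) (symplecticConj e hB g') :=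
  funext fun g => funext fun g' => cocycle_transport e hB hρ r' hU hU' g g'

end ImplementerSection

end Transport

end Literature.RepresentationTheory.HeisenbergGroup
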